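import Mathlib
import HarnessLib
import Literature.AlgebraicGeometry.Resolution.RsopMonomialIdeals
import Literature.AlgebraicGeometry.Resolution.StrictNormalCrossingsAt
import Summits.ResolutionOfSingularities.ResolutionOfSingularities.Theorems.WildQuotientsWildQuotientResolutionCentreGenerators

/-!
# The flag hypotheses of a blow-up step at a point of a regular curve on a regular threefold (crux `WildQuotients.WildQuotientResolution`, Phase 0)

Crux stmt-ResolutionOfSingularities-15640 (`WildQuotientResolution`), line `Sketch` (card
`p-closure-sylow-separation`), registered stub `stub_phaseZeroHighDim`. Bridge from the tree's
«part of a regular system of parameters» packaging (`IsRsopPart`, Matsumura Thm. 14.2,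
`RsopMonomialIdeals.lean` / `RegularCentreRsopPart.lean`: the stalk of the ideal of a REGULAR
centre at a point with regular local ring is generated by an `IsRsopPart` family) to the
generator form of `CentreGenerators.flagCore_data_of_generators`, hence to the four algebraic
hypotheses of the one-step engine `FlagCore.stub_flagCore` /
`CentreBlowupInertia.hasNormalSylow_inertia_of_centreBlowup`:

* `IsRsopPart.forall_mem_of_sum_mul_mem_sq` — the members of a part of a regular system of
  parameters are linearly independent modulo `𝔪²` (coefficient form).
* `flagCore_data_of_isRsopPart_two` — for `c : Fin 2 → R` part of a regular system of parameters
  of a `3`-dimensional regular local ring (`J = (c₀, c₁)`: a regular curve germ on a regular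
  threefold germ): `J ≤ 𝔪`, `J ∩ 𝔪² ⊆ 𝔪 J`, `J̄` spanned by two elements, `𝔪 = J + R v₀ (mod 𝔪²)`.

[OURS · crux stmt-ResolutionOfSingularities-15640 · helper toward `stub_phaseZeroHighDim`; folklore
commutative algebra, counted 0; AI-level work, weaker than expert review.]
-/

-- single-problem summit: the doubled namespace component `ResolutionOfSingularities` is forced
set_option linter.dupNamespace false

open IsLocalRing Literature.AlgebraicGeometry.Resolution
open Summit.ResolutionOfSingularities.ResolutionOfSingularities.Theorems.WildQuotientResolution.CentreGenerators

namespace Summit.ResolutionOfSingularities.ResolutionOfSingularities.Theorems.WildQuotientResolution.CentreRsop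

variable {R : Type*} [CommRing R] [IsLocalRing R]

/-- **Members of a part of a regular system of parameters are independent modulo `𝔪²`**: if
`∑ aᵢ zᵢ ∈ 𝔪²` then every `aᵢ ∈ 𝔪` (`linearIndependent_toCotangent_of_isRegularLocalRing_quotient`
— Matsumura 14.2 — in the coefficient form `linearIndependent_toCotangent_iff_forall_mem`).
[folklore] -/
theorem forall_mem_of_sum_mul_mem_sq {n : ℕ} {z : Fin n → R} (hz : IsRsopPart z)
    (a : Fin n → R) (h : ∑ i, a i * z i ∈ maximalIdeal R ^ 2) : ∀ i, a i ∈ maximalIdeal R := by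
  haveI := hz.isRegularLocalRing
  haveI := hz.isRegularLocalRing_quotient
  have hli := linearIndependent_toCotangent_of_isRegularLocalRing_quotient z hz.mem_maximalIdeal
    fun i => hz.not_mem_span_image (S := {j | j ≠ i}) (i := i) (by simp)
  exact (linearIndependent_toCotangent_iff_forall_mem z hz.mem_maximalIdeal).mp hli a h

/-- **The flag hypotheses at a point of a regular curve on a regular threefold.** Let
`c : Fin 2 → R` be part of a regular system of parameters of the regular local ring `R` of
dimension `3` and `J = (c₀, c₁)` (the stalk of the ideal of a regular curve through a point of a
regular threefold, `exists_isRsopPart_fin_span_range_eq_stalkIdeal`). Then `J ≤ 𝔪`,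
`J ∩ 𝔪² ⊆ 𝔪 J`, `J̄ ⊆ 𝔪/𝔪²` is spanned by the classes of two elements of `J`, and
`𝔪 = J + R v₀` modulo `𝔪²` for some `v₀ ∈ 𝔪` — the hypotheses `hJm`, `hJ2`, `hJgen`, `hVgen` of
`FlagCore.stub_flagCore`. [folklore] -/
theorem flagCore_data_of_isRsopPart_two {c : Fin 2 → R} (hc : IsRsopPart c)
    (hdim : ringKrullDim R = (3 : ℕ)) {J : Ideal R} (hJ : Ideal.span (Set.range c) = J) :
    J ≤ maximalIdeal R ∧
      J ⊓ maximalIdeal R ^ 2 ≤ maximalIdeal R * J ∧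
      (∃ j₁' ∈ J, ∃ j₂' ∈ J, ∀ j ∈ J, ∃ a b : R,
        j - (a * j₁' + b * j₂') ∈ maximalIdeal R ^ 2) ∧
      (∃ v ∈ maximalIdeal R, ∀ r ∈ maximalIdeal R, ∃ a : R, ∃ j ∈ J,
        r - (a * v + j) ∈ maximalIdeal R ^ 2) := by
  obtain ⟨e, y, hde, hspan⟩ := hc.2
  have he : 2 + e = 3 := by
    rw [hdim] at hde
    exact_mod_cast hde.symm
  obtain rfl : e = 1 := by omega
  have hrange : Set.range c = {c 0, c 1} := by
    ext a
    simp only [Set.mem_range, Fin.exists_fin_two, Set.mem_insert_iff, Set.mem_singleton_iff,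
      eq_comm]
  have hy : Set.range y = {y 0} := by
    rw [Set.range_unique]
    rfl
  rw [hrange, hy, Set.union_singleton] at hspan
  refine flagCore_data_of_generators (j₁ := c 0) (j₂ := c 1) (v₀ := y 0)
    (by rw [← hJ, hrange]) hspan.symm fun a b h => ?_
  have h' : ∑ i, (![a, b] : Fin 2 → R) i * c i ∈ maximalIdeal R ^ 2 := by
    rw [Fin.sum_univ_two]
    simpa using h
  have hall := forall_mem_of_sum_mul_mem_sq hc (![a, b]) h'
  exact ⟨by simpa using hall 0, by simpa using hall 1⟩

end Summit.ResolutionOfSingularities.ResolutionOfSingularities.Theorems.WildQuotientResolution.CentreRsop
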